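import Summits.HodgeConjecture.HodgeConjecture.Theorems.R90S6MacdonaldRankOneU2   -- ★ W8-g′ (p03): `doubleCosetOperator_mul_pow_two`, `_mul_self_two`, `eq_basic_two`; brings ★ `card_orbit_basic_two`
import Literature.NumberTheory.Automorphic.HeckeAlgebraDegree                       -- ★ `heckeAlgebra.degree` (an algebra hom), `degree_doubleCosetOperator_eq_natCard`
import HarnessLib

/-!
# R90 · S6 «Ch. 14.1–14.5 stable TF» — CARD SI2: THE `N = 2` SHELL INDEX `#(K₀ tᵐ K₀ ∕ K₀) = (q + 1)·q^{2m−1}` OF THE UNRAMIFIED `U(2) ≅ U(1,1)`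
# (`Theorems/R90S6UnitaryTwoShellIndex.lean`; rows E1.3.9 ∕ E1.4.4.3 — the sphere of radius `2m` of the `(q_v+1)`-regular tree)

Cell `hodgecm-mathlib`, crux H413 (`stmt-HodgeConjecture-24833`), route of record `HCCMUnconditional`; programme R90-TF, section S6 (base `R90-C14`),
seat R90-C14-p02 (g2); S6 dealer R90-C14-plan (g2) CARD SI2 (R90 bus 2026-09-05T02:18:38Z ∕ 02:26:05Z).  Lane `--supports stmt-HodgeConjecture-24833 --as helper`;
THEOREMS ONLY; letters = ★ p03 W8-g′ (`K` a `Valued K ℤᵐ⁰` field, `hd : UnramifiedLocalConjDatum σ ϖ`, `hσ : σ ≠ id`, `t ∈ U₂ = U(σ, antidiag(1,1))(K)` with `↑t = diag(ϖ, ϖ⁻¹)`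
(`ht`), `K₀ = unitaryInt σ H₂`, `φ′_m = doubleCosetOperator K₀ (t ^ m)`, `Q = #𝓀[K]`, `q = Nat.sqrt Q` — at an inert place `q = q_v`, `Q = q_v²`).

CONTENT.  The SHELL INDEX `#(K₀ tᵐ K₀ ∕ K₀) = #(K₀-orbit of the coset tᵐK₀ in U₂ ∕ K₀)` — the number of vertices of the Bruhat–Tits tree of `U(1,1)_w` at distance `2m` from the base
vertex (★ A1 `mem_doubleCoset_pow_iff_dist_eq_two`), i.e. the degree `deg φ′_m` of the Cartan basis element — WITHOUT tree geometry: the degree character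
★ `heckeAlgebra.degree : ℋ →ₐ[ℂ] ℂ` (Shimura Prop. 3.3, `deg T_{KgK} = #(KgK∕K)`) applied to ★ p03's Macdonald recursion `φ′₁φ′_m = φ′_{m+1} + (q−1)φ′_m + Qφ′_{m−1}`,
`φ′₁² = φ′₂ + (q−1)φ′₁ + (Q+q)`, seeded by ★ `card_orbit_basic_two` (`deg φ′₁ = Q + q`), gives `d_{m+1} = (q²+1)d_m − q²d_{m−1}`, whose solution is `(q+1)q^{2m−1}`.
* (SI.2) **`degree_doubleCosetOperator_torusGen_pow_two`**: `deg φ′_m = (q + 1)·q^{2m−1}` (`m ≥ 1`), `deg φ′_0 = 1`.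
* (SI.1) **`natCard_orbit_torusGen_pow_two`**: `Nat.card (K₀ • (tᵐK₀)) = (q + 1)·q^{2m−1}` (`m ≥ 1`; `ncard` form `ncard_orbit_torusGen_pow_two`; `m = 0`: `= 1`).
Degree check: `m = 1`: `Q + q = q(q+1)` ✓ (★ `card_orbit_basic_two`); `m = 2`: `(Q+q)² − (q−1)(Q+q) − (Q+q) = (q+1)q³` ✓.
HONEST LABEL: local index bookkeeping on the `(q_v+1)`-regular tree; proves no orbital-integral identity and no printed global statement; count-neutral until E1.3.9 ∕ E1.4.4.3
consume it.  HC_CM is proved only modulo the 7 printed citations (2 remaining named inputs: hLiu418 = stmt-HodgeConjecture-24832, h413 = stmt-HodgeConjecture-24833) until rung 0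
closes; REL ≠ ★ ≠ BUILT.

## References
* [ShimuraIATAF1971] G. Shimura, *Introduction to the arithmetic theory of automorphic functions* (1971), §3.1 Prop. 3.3 (`deg(ξη) = deg ξ · deg η`).
* [Macdonald1971] I. G. Macdonald, *Spherical functions on a group of p-adic type* (1971), Ch. V §3 (rank one).
* [SerreTrees1980] J.-P. Serre, *Trees* (1980), II.1.1 (the tree of a rank-one group; spheres of radius `n` have `(q+1)qⁿ⁻¹` vertices).
* [BruhatTits1972] F. Bruhat, J. Tits, *Groupes réductifs sur un corps local I*, Publ. Math. IHÉS 41 (1972), (4.4.3)–(4.4.4).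
-/

set_option autoImplicit false
-- the mandated namespace repeats the single-problem summit's segment (`HodgeConjecture.HodgeConjecture`)
set_option linter.dupNamespace false

noncomputable section

open scoped Valued WithZero Matrix MatrixGroups Pointwise
open MulAction

namespace Summit.HodgeConjecture.HodgeConjecture.R90.S6

open Literature.NumberTheory.Automorphic Literature.NumberTheory.Automorphic.HermitianLattice
  Literature.NumberTheory.Automorphic.HermitianLattice.UnramifiedLocalConjDatum Literature.NumberTheory.Automorphic.CartanUnique
  Literature.NumberTheory.Automorphic.heckeAlgebra

/-! ## §0 Light-carrier bookkeeping and the two-step closed form -/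

/-- `f x · f y = f z + a • f u + b • f v` from `x · y = z + a • u + b • v`. [folklore] -/
private theorem shellIndex_algHom_mul {R A B : Type*} [CommSemiring R] [Semiring A] [Semiring B] [Algebra R A] [Algebra R B]
    (f : A →ₐ[R] B) {x y z u v : A} {a b : R} (h : x * y = z + a • u + b • v) : f x * f y = f z + a • f u + b • f v := by
  rw [← map_mul, h, map_add, map_add, map_smul, map_smul]

/-- `f x · f x = f z + a • f x + b • 1` from `x · x = z + a • x + b • 1`. [folklore] -/
private theorem shellIndex_algHom_mul_self {R A B : Type*} [CommSemiring R] [Semiring A] [Semiring B] [Algebra R A] [Algebra R B]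
    (f : A →ₐ[R] B) {x z : A} {a b : R} (h : x * x = z + a • x + b • 1) : f x * f x = f z + a • f x + b • 1 := by
  rw [← map_mul, h, map_add, map_add, map_smul, map_smul, map_one]

/-- **The degree recursion solved**: if `d₁ = q² + q`, `d₁·d₁ = d₂ + (q−1)d₁ + (q²+q)` and `d₁·d_m = d_{m+1} + (q−1)d_m + q²d_{m−1}` (`m ≥ 2`), then
`d_m = (q+1)q^{2m−1}` for `m ≥ 1`. [cite: Macdonald1971, Ch. V §3] [cite: SerreTrees1980, II.1.1] -/
private theorem shellIndex_closed (q : ℂ) (d : ℕ → ℂ) (h1 : d 1 = q ^ 2 + q) (h2 : d 1 * d 1 = d 2 + (q - 1) * d 1 + (q ^ 2 + q) * 1)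
    (hrec : ∀ m, 2 ≤ m → d 1 * d m = d (m + 1) + (q - 1) * d m + q ^ 2 * d (m - 1)) {m : ℕ} (hm : 1 ≤ m) :
    d m = (q + 1) * q ^ (2 * m - 1) := by
  induction m using Nat.strong_induction_on with
  | _ m ih =>
    rcases m with _ | _ | _ | k
    · omega
    · rw [h1]; ring
    · have e : d 2 = d 1 * d 1 - (q - 1) * d 1 - (q ^ 2 + q) * 1 := by rw [h2]; ring
      rw [e, h1]; ring
    · have hk2 := ih (k + 2) (by omega) (by omega)
      have hk1 := ih (k + 1) (by omega) (by omega)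
      have hr := hrec (k + 2) (by omega)
      rw [show k + 2 + 1 = k + 3 from rfl, show k + 2 - 1 = k + 1 from rfl, hk2, hk1, h1] at hr
      rw [show 2 * (k + 2) - 1 = 2 * k + 3 by omega] at hr
      rw [show 2 * (k + 1) - 1 = 2 * k + 1 by omega] at hr
      rw [show 2 * (k + 3) - 1 = 2 * k + 5 by omega]
      linear_combination -hr

/-! ## §1 The shell index at `N = 2` (generic unramified datum) -/

section ShellIndex

variable {K : Type*} [Field K] [Valued K ℤᵐ⁰] {σ : K →+* K} {ϖ : K} [Finite 𝓀[K]]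
  [IsHeckeTriple (⊤ : Submonoid (unitaryGroupOfForm σ ((StdForm.antidiagonal 2).over K))) (unitaryInt σ ((StdForm.antidiagonal 2).over K))
    (unitaryInt σ ((StdForm.antidiagonal 2).over K))]

/-- `((q − 1 : ℕ) : ℂ) = q − 1` (`q = Nat.sqrt #𝓀 ≥ 1` for a non-empty residue field). [folklore] -/
private theorem shellIndex_natCast_sqrt_sub_one : ((Nat.sqrt (Nat.card 𝓀[K]) - 1 : ℕ) : ℂ) = (Nat.sqrt (Nat.card 𝓀[K]) : ℂ) - 1 := by
  haveI : Nonempty 𝓀[K] := ⟨0⟩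
  rw [Nat.cast_sub (Nat.succ_le_of_lt (Nat.sqrt_pos.2 Nat.card_pos)), Nat.cast_one]

omit [Finite 𝓀[K]] in
/-- **`deg φ′₀ = 1`** (`φ′₀ = 1_{K₀}`). [cite: ShimuraIATAF1971, §3.1 Prop. 3.3] -/
theorem degree_doubleCosetOperator_torusGen_pow_zero_two (t : unitaryGroupOfForm σ ((StdForm.antidiagonal 2).over K)) :
    degree (k := ℂ) (unitaryInt σ ((StdForm.antidiagonal 2).over K)) (doubleCosetOperator (unitaryInt σ ((StdForm.antidiagonal 2).over K)) (t ^ 0)) = 1 := by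
  rw [pow_zero, doubleCosetOperator_one, degree_one]

/-- **(SI.2) THE DEGREE OF THE CARTAN BASIS ELEMENT `φ′_m = 1_{K₀ tᵐ K₀}`: `deg φ′_m = (q + 1)·q^{2m−1}`** (`m ≥ 1`, `q = Nat.sqrt #𝓀`) — the degree character
(★ `heckeAlgebra.degree`, an algebra hom) through ★ p03's Macdonald recursion, seeded by ★ `card_orbit_basic_two` (`deg φ′₁ = Q + q`).
[cite: ShimuraIATAF1971, §3.1 Prop. 3.3] [cite: Macdonald1971, Ch. V §3] [cite: SerreTrees1980, II.1.1] -/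
theorem degree_doubleCosetOperator_torusGen_pow_two (hd : UnramifiedLocalConjDatum σ ϖ) (hσ : ∃ x : K, σ x ≠ x)
    (t : unitaryGroupOfForm σ ((StdForm.antidiagonal 2).over K)) (ht : (t : GL (Fin 2) K) = zpowDiagGL (uniformizer_ne_zero hd.vϖ) ![(1 : ℤ), -1])
    {m : ℕ} (hm : 1 ≤ m) :
    degree (k := ℂ) (unitaryInt σ ((StdForm.antidiagonal 2).over K)) (doubleCosetOperator (unitaryInt σ ((StdForm.antidiagonal 2).over K)) (t ^ m)) =
      ((Nat.sqrt (Nat.card 𝓀[K]) : ℂ) + 1) * (Nat.sqrt (Nat.card 𝓀[K]) : ℂ) ^ (2 * m - 1) := by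
  -- `Q = q·q`
  have hQ : ((Nat.card 𝓀[K] : ℕ) : ℂ) = (Nat.sqrt (Nat.card 𝓀[K]) : ℂ) ^ 2 := by
    rw [sq, ← Nat.cast_mul, hd.sqrt_card_residueField_mul_self hσ]
  -- `deg φ′₁ = Q + q` (★ `card_orbit_basic_two`, `t` IS the basic element)
  have h1 : degree (k := ℂ) (unitaryInt σ ((StdForm.antidiagonal 2).over K)) (doubleCosetOperator (unitaryInt σ ((StdForm.antidiagonal 2).over K)) (t ^ 1)) =
      (Nat.sqrt (Nat.card 𝓀[K]) : ℂ) ^ 2 + (Nat.sqrt (Nat.card 𝓀[K]) : ℂ) := by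
    rw [pow_one, degree_doubleCosetOperator, eq_basic_two hd t ht, card_orbit_basic_two hd hσ, Nat.cast_add, hQ]
  refine shellIndex_closed (Nat.sqrt (Nat.card 𝓀[K]) : ℂ)
    (fun m => degree (k := ℂ) (unitaryInt σ ((StdForm.antidiagonal 2).over K)) (doubleCosetOperator (unitaryInt σ ((StdForm.antidiagonal 2).over K)) (t ^ m)))
    h1 ?_ ?_ hm
  · -- `deg` through `φ′₁ · φ′₁ = φ′₂ + (q−1)φ′₁ + (Q+q)·1`
    have h := shellIndex_algHom_mul_self (degree (k := ℂ) (unitaryInt σ ((StdForm.antidiagonal 2).over K))) (doubleCosetOperator_mul_self_two (k := ℂ) hd hσ t ht)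
    rw [shellIndex_natCast_sqrt_sub_one, Nat.cast_add, hQ, smul_eq_mul, smul_eq_mul, ← pow_one t] at h
    rw [pow_one] at h ⊢
    exact h
  · -- `deg` through `φ′₁ · φ′_m = φ′_{m+1} + (q−1)φ′_m + Qφ′_{m−1}`
    intro m hm2
    have h := shellIndex_algHom_mul (degree (k := ℂ) (unitaryInt σ ((StdForm.antidiagonal 2).over K))) (doubleCosetOperator_mul_pow_two (k := ℂ) hd hσ t ht hm2)
    rw [shellIndex_natCast_sqrt_sub_one, hQ, smul_eq_mul, smul_eq_mul] at h
    rw [pow_one]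
    exact h

/-- **(SI.1) THE `N = 2` SHELL INDEX `#(K₀·(tᵐK₀)) = #(K₀ tᵐ K₀ ∕ K₀) = (q + 1)·q^{2m−1}`** (`m ≥ 1`): the `K₀`-orbit of the coset `tᵐK₀` in `U₂ ∕ K₀` — the vertices of the
`(q_v+1)`-regular Bruhat–Tits tree of `U(1,1)_w` at distance `2m` from the base vertex (★ A1 `mem_doubleCoset_pow_iff_dist_eq_two`) — has `(q+1)q^{2m−1}` elements
(★ `degree_doubleCosetOperator_eq_natCard` + (SI.2)). [cite: SerreTrees1980, II.1.1] [cite: ShimuraIATAF1971, §3.1 Prop. 3.3] [cite: BruhatTits1972, (4.4.3)] -/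
theorem natCard_orbit_torusGen_pow_two (hd : UnramifiedLocalConjDatum σ ϖ) (hσ : ∃ x : K, σ x ≠ x)
    (t : unitaryGroupOfForm σ ((StdForm.antidiagonal 2).over K)) (ht : (t : GL (Fin 2) K) = zpowDiagGL (uniformizer_ne_zero hd.vϖ) ![(1 : ℤ), -1])
    {m : ℕ} (hm : 1 ≤ m) :
    Nat.card (orbit (unitaryInt σ ((StdForm.antidiagonal 2).over K))
        ((t ^ m : unitaryGroupOfForm σ ((StdForm.antidiagonal 2).over K)) :
          unitaryGroupOfForm σ ((StdForm.antidiagonal 2).over K) ⧸ unitaryInt σ ((StdForm.antidiagonal 2).over K))) =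
      (Nat.sqrt (Nat.card 𝓀[K]) + 1) * Nat.sqrt (Nat.card 𝓀[K]) ^ (2 * m - 1) := by
  have h := (degree_doubleCosetOperator_eq_natCard (k := ℂ) (unitaryInt σ ((StdForm.antidiagonal 2).over K)) (t ^ m)).symm.trans
    (degree_doubleCosetOperator_torusGen_pow_two hd hσ t ht hm)
  exact_mod_cast h

/-- (SI.1), `ncard` form: `(K₀·(tᵐK₀)).ncard = (q + 1)·q^{2m−1}` (`m ≥ 1`). [cite: SerreTrees1980, II.1.1] -/
theorem ncard_orbit_torusGen_pow_two (hd : UnramifiedLocalConjDatum σ ϖ) (hσ : ∃ x : K, σ x ≠ x)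
    (t : unitaryGroupOfForm σ ((StdForm.antidiagonal 2).over K)) (ht : (t : GL (Fin 2) K) = zpowDiagGL (uniformizer_ne_zero hd.vϖ) ![(1 : ℤ), -1])
    {m : ℕ} (hm : 1 ≤ m) :
    (orbit (unitaryInt σ ((StdForm.antidiagonal 2).over K))
        ((t ^ m : unitaryGroupOfForm σ ((StdForm.antidiagonal 2).over K)) :
          unitaryGroupOfForm σ ((StdForm.antidiagonal 2).over K) ⧸ unitaryInt σ ((StdForm.antidiagonal 2).over K))).ncard =
      (Nat.sqrt (Nat.card 𝓀[K]) + 1) * Nat.sqrt (Nat.card 𝓀[K]) ^ (2 * m - 1) := by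
  rw [← Nat.card_coe_set_eq, natCard_orbit_torusGen_pow_two hd hσ t ht hm]

omit [Finite 𝓀[K]] in
/-- (SI.1) at `m = 0`: the orbit of the base coset is a point, `#(K₀·K₀) = 1`. [cite: SerreTrees1980, II.1.1] -/
theorem natCard_orbit_torusGen_pow_zero_two (t : unitaryGroupOfForm σ ((StdForm.antidiagonal 2).over K)) :
    Nat.card (orbit (unitaryInt σ ((StdForm.antidiagonal 2).over K))
        ((t ^ 0 : unitaryGroupOfForm σ ((StdForm.antidiagonal 2).over K)) :
          unitaryGroupOfForm σ ((StdForm.antidiagonal 2).over K) ⧸ unitaryInt σ ((StdForm.antidiagonal 2).over K))) = 1 := by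
  have h := (degree_doubleCosetOperator_eq_natCard (k := ℂ) (unitaryInt σ ((StdForm.antidiagonal 2).over K)) (t ^ 0)).symm.trans
    (degree_doubleCosetOperator_torusGen_pow_zero_two t)
  exact_mod_cast h

end ShellIndex

end Summit.HodgeConjecture.HodgeConjecture.R90.S6

end
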